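import Summits.ABC.IUTFork.Conditional.AbcOfSGenuineKLinUniform
import HarnessLib

/-!
# R-W lane U/P−: the local-type-uniform [LIN] decider made UNIFORM IN THE PRIME `l` — band certificates
# (`GenuineK.not_pilotKummerCompatHull_chosen_triple_of_linUniform_band` / `_cert`)

PROOF-ONLY file (no `def`, no new `Prop`, no instance) of the abc-iut cell (D-0079 R-W numerics crew seat abc-iut-W-num-6, gen 2;
row «W:F3-LINU-BANDS»). TAKES NO SIDE on [IUTchIII] Cor. 3.12 or on any author. NO new engine: abc-iut-w5-d107's e-free decider
`GenuineK.not_pilotKummerCompatHull_chosen_triple_of_linUniform` (p464182; `p ∉ {2,3,5,l}`, `p^v ∣ abc`, `30·l < p^B·(p−1)`, label `i₀+1 ≤ l⋆`,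
integer test `2l·((i₀+2)((B+1)(p−2)+1) + (p−2)) ≤ 2v·i₀(i₀+2)(p−2)`) is instantiated ONCE at the top-but-one label `i₀ = (l−3)/2` of an odd prime `l ≥ 5`,
where the test reads (multiplied by 2, `K₁ := (B+1)(p−2)+1`, `K₃ := p−2`)
  **`2l·((l+1)·K₁ + 2K₃) + 3v·(l+1)·K₃ ≤ v·l(l+1)·K₃`**, a QUADRATIC inequality `P(l) = A·l² + B'·l + C ≥ 0` in `l` with `A = v·K₃ − 2K₁`.
* §1 `LinUniformBand.test_of_cert`: the three-numeral certificate `2K₁ ≤ v·K₃` (A ≥ 0), `2vK₃ + 2K₁ + 4K₃ + 4K₁·l₀ ≤ 2vK₃·l₀` (vertex left of `l₀`),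
  `P(l₀) ≥ 0` gives the test for EVERY `l ≥ l₀` (pure `ℕ`/`ℤ` arithmetic).
* §2 `GenuineK.not_pilotKummerCompatHull_chosen_triple_of_linUniform_band`: the polynomial form of the test at one odd prime `l ≥ 5` ⇒ ¬ S_H at EVERY genuine
  Θ-volume datum over `(ratPoint (a/c), l)` (chosen realising ideles, pinned reading, every free binder) — p464182 at `i₀ = (l−3)/2`.
* §3 `GenuineK.not_pilotKummerCompatHull_chosen_triple_of_linUniform_cert`: §1 + §2 — ONE certificate `(p, v, B, l₀)` decides the refuted side for every
  prime `l₀ ≤ l` with `30·l < p^B·(p−1)`, i.e. a whole BAND of R-W table rows `pilotDataOfK:frey-a-b-c:l` by one theorem (the per-triple band theorems are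
  filed separately as `…LinUniformBandRows*`). Desk census (HOME/abc-iut-W-num-6, work/bands): 51 bands cover exactly the 1,907 LINU-decidable Szpiro-bad
  (known triple, l) pairs of the R-W numerics lead's TE30-CENSUS v2.
HONEST SCOPE as in the parent: SHARP reading; per-label licence STRONGER than print; admissibility / Szpiro-badness / (P6) / non-emptiness of the datum type
NOT claimed; «refuted as typed» ≠ «refuted in print»; nothing about the number-level Corollary; typed ≠ proved; instantiated ≠ endorsed.
[cite: Mochizuki2012, IUTchIII Cor. 3.12 Step (xi-f) p. 184; IUTchIV Prop. 1.2 p. 10, Cor. 2.2 (ii) proof p. 44–46] [cite: MochizukiGenEll2010, Thm. 2.1 p. 11]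
[claim: Mochizuki2012, status: disputed] for every IUT sentence quoted.
-/

noncomputable section

open Set Function NumberField IsDedekindDomain

namespace Summit.ABC.IUTFork.Conditional

open Thm311 Thm311.Real Cor312 Cor312Vol Cor312Prov Literature.IUT.LogThetaLattice Literature.IUT.LogVolume
  Literature.IUT.HodgeTheaters Literature.IUT.LogVolume.ThetaData Literature.IUT.LogVolume.Cor22
open Literature.NumberTheory.NumberFields Literature.NumberTheory.GaloisRepresentations.Ultrametric
open Literature.NumberTheory.DiophantineGeometry Literature.NumberTheory.DiophantineGeometry.GenEll Summit.ABC.ABC.Theorems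

/-! ## §1. The quadratic certificate (pure arithmetic) -/

/-- **Band certificate.** With `K₁, K₃, v, l₀ : ℕ`: if `2K₁ ≤ v·K₃` (leading coefficient `A = vK₃ − 2K₁ ≥ 0`),
`2vK₃ + 2K₁ + 4K₃ + 4K₁·l₀ ≤ 2vK₃·l₀` (i.e. `2A·l₀ + B' ≥ 0`, the vertex of `P` lies left of `l₀`) and the test holds at `l₀`,
then the polynomial test `2l·((l+1)K₁ + 2K₃) + 3v·(l+1)K₃ ≤ v·l(l+1)·K₃` holds at EVERY `l ≥ l₀`
(`P(l) = P(l₀) + A(l−l₀)² + (2Al₀+B')(l−l₀)`). [folklore] -/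
theorem LinUniformBand.test_of_cert (K₁ K₃ v l₀ : ℕ) (hA : 2 * K₁ ≤ v * K₃)
    (h1 : 2 * v * K₃ + 2 * K₁ + 4 * K₃ + 4 * K₁ * l₀ ≤ 2 * v * K₃ * l₀)
    (h0 : 2 * l₀ * ((l₀ + 1) * K₁ + 2 * K₃) + 3 * v * ((l₀ + 1) * K₃) ≤ v * (l₀ * (l₀ + 1)) * K₃) {l : ℕ} (hl : l₀ ≤ l) :
    2 * l * ((l + 1) * K₁ + 2 * K₃) + 3 * v * ((l + 1) * K₃) ≤ v * (l * (l + 1)) * K₃ := by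
  obtain ⟨m, rfl⟩ := Nat.exists_eq_add_of_le hl
  have hA' : (2 : ℤ) * K₁ ≤ (v : ℤ) * K₃ := by exact_mod_cast hA
  have h1' : (2 : ℤ) * v * K₃ + 2 * K₁ + 4 * K₃ + 4 * K₁ * l₀ ≤ 2 * v * K₃ * l₀ := by exact_mod_cast h1
  have h0' : (2 : ℤ) * l₀ * ((l₀ + 1) * K₁ + 2 * K₃) + 3 * v * ((l₀ + 1) * K₃) ≤ v * (l₀ * (l₀ + 1)) * K₃ := by exact_mod_cast h0
  have hm : (0 : ℤ) ≤ m := by exact_mod_cast Nat.zero_le m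
  have key : (2 : ℤ) * (l₀ + m) * ((l₀ + m + 1) * K₁ + 2 * K₃) + 3 * v * ((l₀ + m + 1) * K₃) ≤ v * ((l₀ + m) * (l₀ + m + 1)) * K₃ := by
    nlinarith [mul_nonneg (mul_nonneg hm hm) (sub_nonneg.2 hA'), mul_nonneg hm (sub_nonneg.2 h1')]
  exact_mod_cast key

/-! ## §2. The [LIN]-uniform decider at the top-but-one label `i₀ = (l−3)/2` -/

/-- **abc-TRIPLE form of the e-free [LIN] decider at the label `j = i₀ + 1 = l⋆` with `i₀ = (l−3)/2`, polynomial test in `l`.** `a + b = c` coprime,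
`T` a genuine Θ-volume datum over `(ratPoint (a/c), l)` with `l ≥ 5` odd, a prime `p ∉ {2, 3, 5, l}`, `B` with `30·l < p^B·(p−1)`, `p^v ∣ abc` (`v ≥ 1`),
and **`2l·((l+1)·((B+1)(p−2)+1) + 2(p−2)) + 3v·(l+1)(p−2) ≤ v·l(l+1)·(p−2)`** (= twice p464182's test at `i₀ = (l−3)/2`) ⇒ the hull-level clause S_H
(chosen realising ideles, pinned reading) FAILS at `T` for every choice of the free context binders and Kummer datum.
[cite: Mochizuki2012, IUTchIII Cor. 3.12 Step (xi-f) p. 184; IUTchIV Prop. 1.2 p. 10] [cite: MochizukiGenEll2010, Thm. 2.1 p. 11] [claim: Mochizuki2012, status: disputed] -/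
theorem GenuineK.not_pilotKummerCompatHull_chosen_triple_of_linUniform_band {a b c : ℕ} (habc : IsABCTriple a b c) {l : ℕ}
    (T : Cor22.ThetaVolumeDatumAt (ratPoint ((a : ℚ) / c)) l) (pp : Nat.Primes) (hp2 : (pp : ℕ) ≠ 2) (hp3 : (pp : ℕ) ≠ 3)
    (hp5 : (pp : ℕ) ≠ 5) (hpl : (pp : ℕ) ≠ l) (B : ℕ) (hB : 30 * l < (pp : ℕ) ^ B * ((pp : ℕ) - 1)) (v : ℕ) (hv : 1 ≤ v)
    (hdvd : (pp : ℕ) ^ v ∣ a * b * c) (hl5 : 5 ≤ l) (hlodd : Odd l)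
    (htest : 2 * l * ((l + 1) * ((B + 1) * ((pp : ℕ) - 2) + 1) + 2 * ((pp : ℕ) - 2)) + 3 * v * ((l + 1) * ((pp : ℕ) - 2))
      ≤ v * (l * (l + 1)) * ((pp : ℕ) - 2)) :
    letI := T.instFieldF; letI := T.instNumberFieldF; letI := T.instAlgebraF; letI := T.instFieldK
    letI := T.instNumberFieldK; letI := T.instAlgebraK; letI := T.instFieldFbar; letI := T.instAlgebraFbar
    letI := T.instAlgebraKFbar; letI := T.instIsElliptic
    ∀ (M : Type) [Field M] [NumberField M]
      (archPk : ∀ (j : (thetaIndex (pilotDataOfK T.D T.K)).Label) (vQ : (thetaIndex (pilotDataOfK T.D T.K)).VQ),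
        Set ((logShellsDH (pilotDataOfK T.D T.K) (analyticLogv T.K)).Packet j vQ))
      (archSub : ∀ (j : (thetaIndex (pilotDataOfK T.D T.K)).Label) (v : (thetaIndex (pilotDataOfK T.D T.K)).V),
        Set ((logShellsDH (pilotDataOfK T.D T.K) (analyticLogv T.K)).Packet j ((thetaIndex (pilotDataOfK T.D T.K)).over v)))
      (Ψ : ℤ → ∀ v : (thetaIndex (pilotDataOfK T.D T.K)).V, v ∈ (thetaIndex (pilotDataOfK T.D T.K)).Vbad →
        Set ((logShellsDH (pilotDataOfK T.D T.K) (analyticLogv T.K)).StarPacket v))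
      (act : ℤ → ∀ v : (thetaIndex (pilotDataOfK T.D T.K)).V, v ∈ (thetaIndex (pilotDataOfK T.D T.K)).Vbad →
        (logShellsDH (pilotDataOfK T.D T.K) (analyticLogv T.K)).StarPacket v →
          Module.End ℚ ((logShellsDH (pilotDataOfK T.D T.K) (analyticLogv T.K)).StarPacket v))
      (Mmod : ℤ → ∀ j : (thetaIndex (pilotDataOfK T.D T.K)).LabelStar, Set ((logShellsDH (pilotDataOfK T.D T.K) (analyticLogv T.K)).GlobalPacket j.1))
      (region : ℤ → ∀ j : (thetaIndex (pilotDataOfK T.D T.K)).LabelStar, FinDivisor M → ∀ vQ : (thetaIndex (pilotDataOfK T.D T.K)).VQ,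
        Set ((logShellsDH (pilotDataOfK T.D T.K) (analyticLogv T.K)).Packet j.1 vQ))
      (frobAdm : ℤ → ℤ → ∀ (j : (thetaIndex (pilotDataOfK T.D T.K)).Label) (vQ : (thetaIndex (pilotDataOfK T.D T.K)).VQ),
        Set ((logShellsDH (pilotDataOfK T.D T.K) (analyticLogv T.K)).Packet j vQ) → Prop)
      (frobLogvol : ℤ → ℤ → ∀ (j : (thetaIndex (pilotDataOfK T.D T.K)).Label) (vQ : (thetaIndex (pilotDataOfK T.D T.K)).VQ),
        Set ((logShellsDH (pilotDataOfK T.D T.K) (analyticLogv T.K)).Packet j vQ) → ℝ)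
      (frobΨ : ℤ → ℤ → ∀ v : (thetaIndex (pilotDataOfK T.D T.K)).V, v ∈ (thetaIndex (pilotDataOfK T.D T.K)).Vbad →
        Set ((logShellsDH (pilotDataOfK T.D T.K) (analyticLogv T.K)).StarPacket v))
      (frobMmod : ℤ → ℤ → ∀ j : (thetaIndex (pilotDataOfK T.D T.K)).LabelStar, Set ((logShellsDH (pilotDataOfK T.D T.K) (analyticLogv T.K)).GlobalPacket j.1))
      (unitImage : ℤ → ℤ → ℕ → ∀ (j : (thetaIndex (pilotDataOfK T.D T.K)).Label) (vQ : (thetaIndex (pilotDataOfK T.D T.K)).VQ),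
        Set ((logShellsDH (pilotDataOfK T.D T.K) (analyticLogv T.K)).Packet j vQ))
      (ballImage : ℤ → ℤ → ∀ (j : (thetaIndex (pilotDataOfK T.D T.K)).Label) (vQ : (thetaIndex (pilotDataOfK T.D T.K)).VQ),
        Set ((logShellsDH (pilotDataOfK T.D T.K) (analyticLogv T.K)).Packet j vQ))
      (thetaDiv : ℤ → ℤ → LgpDivisor M (thetaIndex (pilotDataOfK T.D T.K)).lstar)
      (n : ℤ) {HT : Type} {LogLink : HT → HT → Type} {IsFull : ∀ {s t : HT}, LogLink s t → Prop}
      (lat : LGPGaussianLogThetaLattice LogLink IsFull)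
      {Frd : Type} {IsoF : Frd → Frd → Type} {Ob : Frd → Type} {realify : Frd → Frd} {Strip : Type}
      {IsoS : Strip → Strip → Type} {Mv : ∀ v : (thetaIndex (pilotDataOfK T.D T.K)).V, v ∈ (thetaIndex (pilotDataOfK T.D T.K)).Vbad → Type}
      [∀ v h, Monoid (Mv v h)]
      (sig : GlobalLGPFrobenioidSignature (thetaIndex (pilotDataOfK T.D T.K)).lstar (thetaIndex (pilotDataOfK T.D T.K)).V
        (· ∈ (thetaIndex (pilotDataOfK T.D T.K)).Vbad) Frd IsoF Ob realify Strip IsoS Mv)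
      (split : SplittingMonoids Mv) {ObΔ : Type} {N : ∀ v : (thetaIndex (pilotDataOfK T.D T.K)).V, v ∈ (thetaIndex (pilotDataOfK T.D T.K)).Vbad → Type}
      [∀ v h, Monoid (N v h)] (qData : QPilotData ObΔ N)
      (qK : ∀ v : (thetaIndex (pilotDataOfK T.D T.K)).V, v ∈ (thetaIndex (pilotDataOfK T.D T.K)).Vbad →
        Set ((logShellsDH (pilotDataOfK T.D T.K) (analyticLogv T.K)).StarPacket v)),
      ¬ Cor312Vol.PilotKummerCompatHull
          (LatticeSituation.ofShells (logShellsDH (pilotDataOfK T.D T.K) (analyticLogv T.K)) M archPk archSub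
            (summandPiecesPr (pilotDataOfK T.D T.K) (logvAnalytic_analyticLogv (F := T.K))).Adm
            (summandPiecesPr (pilotDataOfK T.D T.K) (logvAnalytic_analyticLogv (F := T.K))).logvol Ψ act Mmod region frobAdm frobLogvol frobΨ
            frobMmod unitImage ballImage thetaDiv)
          (settingPrVolSharp (pilotDataOfK T.D T.K) (logvAnalytic_analyticLogv (F := T.K)) M archPk archSub Ψ act Mmod region n lat sig split qData
            (exists_realising_qIdeles_pilotDataOfK T.D).choose (exists_realising_thetaIdeles_pilotDataOfK T.D).choose
            (exists_realising_qIdeles_pilotDataOfK T.D).choose_spec.1 (exists_realising_qIdeles_pilotDataOfK T.D).choose_spec.2.1)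
          (fun _ => Cor312.Setting.qRegion
            (settingPrVolSharp (pilotDataOfK T.D T.K) (logvAnalytic_analyticLogv (F := T.K)) M archPk archSub Ψ act Mmod region n lat sig split qData
              (exists_realising_qIdeles_pilotDataOfK T.D).choose (exists_realising_thetaIdeles_pilotDataOfK T.D).choose
              (exists_realising_qIdeles_pilotDataOfK T.D).choose_spec.1 (exists_realising_qIdeles_pilotDataOfK T.D).choose_spec.2.1)) qK := by
  obtain ⟨m, hm⟩ := hlodd
  obtain ⟨i₀, rfl⟩ : ∃ i₀, m = i₀ + 1 := ⟨m - 1, by omega⟩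
  -- `l = 2·i₀ + 3`, so `i₀ = (l−3)/2`, `i₀ + 2 = (l+1)/2`, `i₀ + 1 = (l−1)/2 = l⋆`
  have hil : i₀ + 1 ≤ (l - 1) / 2 := by omega
  refine GenuineK.not_pilotKummerCompatHull_chosen_triple_of_linUniform habc T pp hp2 hp3 hp5 hpl B hB v hv hdvd i₀ hil ?_
  -- the test at `i₀`: `htest` is exactly twice it once `l = 2 i₀ + 3`
  subst hm
  set K₃ : ℕ := (pp : ℕ) - 2
  set K₁ : ℕ := (B + 1) * K₃ + 1
  have e1 : 2 * (2 * (i₀ + 1) + 1) * ((2 * (i₀ + 1) + 1 + 1) * K₁ + 2 * K₃) + 3 * v * ((2 * (i₀ + 1) + 1 + 1) * K₃)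
      = 2 * (2 * (2 * (i₀ + 1) + 1) * ((i₀ + 2) * K₁ + K₃)) + 6 * v * ((i₀ + 2) * K₃) := by ring
  have e2 : v * ((2 * (i₀ + 1) + 1) * (2 * (i₀ + 1) + 1 + 1)) * K₃ = 2 * (2 * v * (i₀ * (i₀ + 2)) * K₃) + 6 * v * ((i₀ + 2) * K₃) := by ring
  have h := htest
  rw [e1, e2] at h
  exact Nat.le_of_mul_le_mul_left (Nat.le_of_add_le_add_right h) (by norm_num)

/-! ## §3. The band certificate form -/

/-- **BAND CERTIFICATE FORM.** `a + b = c` coprime, a prime `p ∉ {2, 3, 5}`, `p^v ∣ abc` (`v ≥ 1`), `B l₀ : ℕ` with the three-numeral certificate of §1 for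
`K₁ = (B+1)(p−2)+1`, `K₃ = p−2` (`2K₁ ≤ vK₃`, `2vK₃ + 2K₁ + 4K₃ + 4K₁l₀ ≤ 2vK₃l₀`, test at `l₀`). THEN for EVERY prime `l ≠ p` with `5 ≤ l`, `l₀ ≤ l` and
`30·l < p^B·(p−1)`: ¬ S_H at every genuine Θ-volume datum over `(ratPoint (a/c), l)` (chosen realising ideles, pinned reading, every free binder) — a whole band
of R-W rows `pilotDataOfK:frey-a-b-c:l` by one certificate. [cite: Mochizuki2012, IUTchIII Cor. 3.12 Step (xi-f) p. 184; IUTchIV Prop. 1.2 p. 10]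
[cite: MochizukiGenEll2010, Thm. 2.1 p. 11] [claim: Mochizuki2012, status: disputed] -/
theorem GenuineK.not_pilotKummerCompatHull_chosen_triple_of_linUniform_cert {a b c : ℕ} (habc : IsABCTriple a b c) {l : ℕ}
    (T : Cor22.ThetaVolumeDatumAt (ratPoint ((a : ℚ) / c)) l) (pp : Nat.Primes) (hp2 : (pp : ℕ) ≠ 2) (hp3 : (pp : ℕ) ≠ 3)
    (hp5 : (pp : ℕ) ≠ 5) (hpl : (pp : ℕ) ≠ l) (B : ℕ) (hB : 30 * l < (pp : ℕ) ^ B * ((pp : ℕ) - 1)) (v : ℕ) (hv : 1 ≤ v)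
    (hdvd : (pp : ℕ) ^ v ∣ a * b * c) (hl : l.Prime) (hl5 : 5 ≤ l) (l₀ : ℕ) (hl0 : l₀ ≤ l)
    (hA : 2 * ((B + 1) * ((pp : ℕ) - 2) + 1) ≤ v * ((pp : ℕ) - 2))
    (h1 : 2 * v * ((pp : ℕ) - 2) + 2 * ((B + 1) * ((pp : ℕ) - 2) + 1) + 4 * ((pp : ℕ) - 2) + 4 * ((B + 1) * ((pp : ℕ) - 2) + 1) * l₀
      ≤ 2 * v * ((pp : ℕ) - 2) * l₀)
    (h0 : 2 * l₀ * ((l₀ + 1) * ((B + 1) * ((pp : ℕ) - 2) + 1) + 2 * ((pp : ℕ) - 2)) + 3 * v * ((l₀ + 1) * ((pp : ℕ) - 2))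
      ≤ v * (l₀ * (l₀ + 1)) * ((pp : ℕ) - 2)) :

    letI := T.instFieldF; letI := T.instNumberFieldF; letI := T.instAlgebraF; letI := T.instFieldK
    letI := T.instNumberFieldK; letI := T.instAlgebraK; letI := T.instFieldFbar; letI := T.instAlgebraFbar
    letI := T.instAlgebraKFbar; letI := T.instIsElliptic
    ∀ (M : Type) [Field M] [NumberField M]
      (archPk : ∀ (j : (thetaIndex (pilotDataOfK T.D T.K)).Label) (vQ : (thetaIndex (pilotDataOfK T.D T.K)).VQ),
        Set ((logShellsDH (pilotDataOfK T.D T.K) (analyticLogv T.K)).Packet j vQ))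
      (archSub : ∀ (j : (thetaIndex (pilotDataOfK T.D T.K)).Label) (v : (thetaIndex (pilotDataOfK T.D T.K)).V),
        Set ((logShellsDH (pilotDataOfK T.D T.K) (analyticLogv T.K)).Packet j ((thetaIndex (pilotDataOfK T.D T.K)).over v)))
      (Ψ : ℤ → ∀ v : (thetaIndex (pilotDataOfK T.D T.K)).V, v ∈ (thetaIndex (pilotDataOfK T.D T.K)).Vbad →
        Set ((logShellsDH (pilotDataOfK T.D T.K) (analyticLogv T.K)).StarPacket v))
      (act : ℤ → ∀ v : (thetaIndex (pilotDataOfK T.D T.K)).V, v ∈ (thetaIndex (pilotDataOfK T.D T.K)).Vbad →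
        (logShellsDH (pilotDataOfK T.D T.K) (analyticLogv T.K)).StarPacket v →
          Module.End ℚ ((logShellsDH (pilotDataOfK T.D T.K) (analyticLogv T.K)).StarPacket v))
      (Mmod : ℤ → ∀ j : (thetaIndex (pilotDataOfK T.D T.K)).LabelStar, Set ((logShellsDH (pilotDataOfK T.D T.K) (analyticLogv T.K)).GlobalPacket j.1))
      (region : ℤ → ∀ j : (thetaIndex (pilotDataOfK T.D T.K)).LabelStar, FinDivisor M → ∀ vQ : (thetaIndex (pilotDataOfK T.D T.K)).VQ,
        Set ((logShellsDH (pilotDataOfK T.D T.K) (analyticLogv T.K)).Packet j.1 vQ))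
      (frobAdm : ℤ → ℤ → ∀ (j : (thetaIndex (pilotDataOfK T.D T.K)).Label) (vQ : (thetaIndex (pilotDataOfK T.D T.K)).VQ),
        Set ((logShellsDH (pilotDataOfK T.D T.K) (analyticLogv T.K)).Packet j vQ) → Prop)
      (frobLogvol : ℤ → ℤ → ∀ (j : (thetaIndex (pilotDataOfK T.D T.K)).Label) (vQ : (thetaIndex (pilotDataOfK T.D T.K)).VQ),
        Set ((logShellsDH (pilotDataOfK T.D T.K) (analyticLogv T.K)).Packet j vQ) → ℝ)
      (frobΨ : ℤ → ℤ → ∀ v : (thetaIndex (pilotDataOfK T.D T.K)).V, v ∈ (thetaIndex (pilotDataOfK T.D T.K)).Vbad →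
        Set ((logShellsDH (pilotDataOfK T.D T.K) (analyticLogv T.K)).StarPacket v))
      (frobMmod : ℤ → ℤ → ∀ j : (thetaIndex (pilotDataOfK T.D T.K)).LabelStar, Set ((logShellsDH (pilotDataOfK T.D T.K) (analyticLogv T.K)).GlobalPacket j.1))
      (unitImage : ℤ → ℤ → ℕ → ∀ (j : (thetaIndex (pilotDataOfK T.D T.K)).Label) (vQ : (thetaIndex (pilotDataOfK T.D T.K)).VQ),
        Set ((logShellsDH (pilotDataOfK T.D T.K) (analyticLogv T.K)).Packet j vQ))
      (ballImage : ℤ → ℤ → ∀ (j : (thetaIndex (pilotDataOfK T.D T.K)).Label) (vQ : (thetaIndex (pilotDataOfK T.D T.K)).VQ),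
        Set ((logShellsDH (pilotDataOfK T.D T.K) (analyticLogv T.K)).Packet j vQ))
      (thetaDiv : ℤ → ℤ → LgpDivisor M (thetaIndex (pilotDataOfK T.D T.K)).lstar)
      (n : ℤ) {HT : Type} {LogLink : HT → HT → Type} {IsFull : ∀ {s t : HT}, LogLink s t → Prop}
      (lat : LGPGaussianLogThetaLattice LogLink IsFull)
      {Frd : Type} {IsoF : Frd → Frd → Type} {Ob : Frd → Type} {realify : Frd → Frd} {Strip : Type}
      {IsoS : Strip → Strip → Type} {Mv : ∀ v : (thetaIndex (pilotDataOfK T.D T.K)).V, v ∈ (thetaIndex (pilotDataOfK T.D T.K)).Vbad → Type}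
      [∀ v h, Monoid (Mv v h)]
      (sig : GlobalLGPFrobenioidSignature (thetaIndex (pilotDataOfK T.D T.K)).lstar (thetaIndex (pilotDataOfK T.D T.K)).V
        (· ∈ (thetaIndex (pilotDataOfK T.D T.K)).Vbad) Frd IsoF Ob realify Strip IsoS Mv)
      (split : SplittingMonoids Mv) {ObΔ : Type} {N : ∀ v : (thetaIndex (pilotDataOfK T.D T.K)).V, v ∈ (thetaIndex (pilotDataOfK T.D T.K)).Vbad → Type}
      [∀ v h, Monoid (N v h)] (qData : QPilotData ObΔ N)
      (qK : ∀ v : (thetaIndex (pilotDataOfK T.D T.K)).V, v ∈ (thetaIndex (pilotDataOfK T.D T.K)).Vbad →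
        Set ((logShellsDH (pilotDataOfK T.D T.K) (analyticLogv T.K)).StarPacket v)),
      ¬ Cor312Vol.PilotKummerCompatHull
          (LatticeSituation.ofShells (logShellsDH (pilotDataOfK T.D T.K) (analyticLogv T.K)) M archPk archSub
            (summandPiecesPr (pilotDataOfK T.D T.K) (logvAnalytic_analyticLogv (F := T.K))).Adm
            (summandPiecesPr (pilotDataOfK T.D T.K) (logvAnalytic_analyticLogv (F := T.K))).logvol Ψ act Mmod region frobAdm frobLogvol frobΨ
            frobMmod unitImage ballImage thetaDiv)
          (settingPrVolSharp (pilotDataOfK T.D T.K) (logvAnalytic_analyticLogv (F := T.K)) M archPk archSub Ψ act Mmod region n lat sig split qData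
            (exists_realising_qIdeles_pilotDataOfK T.D).choose (exists_realising_thetaIdeles_pilotDataOfK T.D).choose
            (exists_realising_qIdeles_pilotDataOfK T.D).choose_spec.1 (exists_realising_qIdeles_pilotDataOfK T.D).choose_spec.2.1)
          (fun _ => Cor312.Setting.qRegion
            (settingPrVolSharp (pilotDataOfK T.D T.K) (logvAnalytic_analyticLogv (F := T.K)) M archPk archSub Ψ act Mmod region n lat sig split qData
              (exists_realising_qIdeles_pilotDataOfK T.D).choose (exists_realising_thetaIdeles_pilotDataOfK T.D).choose
              (exists_realising_qIdeles_pilotDataOfK T.D).choose_spec.1 (exists_realising_qIdeles_pilotDataOfK T.D).choose_spec.2.1)) qK :=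
  GenuineK.not_pilotKummerCompatHull_chosen_triple_of_linUniform_band habc T pp hp2 hp3 hp5 hpl B hB v hv hdvd hl5
    (hl.odd_of_ne_two (by omega)) (LinUniformBand.test_of_cert ((B + 1) * ((pp : ℕ) - 2) + 1) ((pp : ℕ) - 2) v l₀ hA h1 h0 hl0)

end Summit.ABC.IUTFork.Conditional

end
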